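import Literature.Probability.Percolation.MarkedLoopBoundaryLawModule
import Literature.Probability.LatticeModels.TemperleyLiebCapContract
import HarnessLib

/-!
# Contracting two adjacent corners of an outermost pattern: the pattern map behind `contractL`, its link-relation formula, and the law assembly («PAT-CONTRACT»)

Topic `Literature/Probability/Percolation`; a rider on `MarkedLoopTemperleyLiebCoords.lean` (`pat₀EquivLinkPattern k : Pat₀ k ≃ LinkPattern (k+1)`: close the
disorder's partner up to a new last site `*`, read the pairing), `MarkedLoopBoundaryLawModule.lean` («BOUNDARY-LAW-MODULE»: `lawLP z`, the boundary link-pattern law of a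
boundary mid-edge as a vector of the planar Temperley–Lieb module) and `LatticeModels/TemperleyLiebCapContract.lean` («TL-CAP-CONTRACT»: `skip j`, `LinkPattern.contractSucc j`
— connect the sites `j, j+1` (a loop of weight `1` if they were partners) and delete them —, `contractL R j = Finsupp.lmapDomain (contractSucc j)`).

Pearce–Rittenberg–de Gier–Nienhuis's contraction half of the monoid move `e_j` (§2: «placing the graph of the generator under the word and erasing the intermediate dashed
line» — the cup under `j, j+1` joins the two strands ending there; a closed loop has weight `q + q⁻¹ = 1`), transported to Khristoforov–Smirnov's (partner, link relation)
PATTERNS of a loop configuration with `k+2` boundary disorders (§1.2: «IP(ξ) is a union of disjoint paths, matching marked points … the law of the link pattern»):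

* `Pat₀.contract j q` — **THE CONTRACTION OF AN OUTERMOST PATTERN `q` of `k+2` corners AT THE ADJACENT CORNERS `j, j+1`**, an outermost pattern of `k` corners (the other
  corners relabelled by `skip j`); DEFINED through the bridge: `pat₀EquivLinkPattern k (q.contract j) = (pat₀EquivLinkPattern (k+2) q).contractSucc j`
  (`pat₀EquivLinkPattern_contract`);
* ★★ `Pat₀.mem_contract_iff` — **ITS LINK RELATION IN CLOSED FORM**: the corners `a, b` are linked in `q.contract j` iff, in `q`, `skip j a ~ skip j b`, or `skip j a ~ j` and
  `j+1 ~ skip j b`, or `skip j a ~ j+1` and `j ~ skip j b` — the strands through `j` and `j+1` are JOINED (exactly the reachability bookkeeping of attaching a path of open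
  bonds between the corner faces `y_j`, `y_{j+1}`: `MarkedLoopLawSlide` §1 `reachable_union_pendant_root` for one root, the two-root form for two);
* ★★ `Pat₀.contract_partner_eq_iff` — **ITS PARTNER IN CLOSED FORM**: the disorder's partner in `q.contract j` is `x` iff `skip j x` is the partner in `q`,
  or `skip j x ~ j` and the partner is `j+1`, or `skip j x ~ j+1` and the partner is `j`;
* `contractL_apply_eq_sum` — `(contractL j f) P = Σ_{Q : contractSucc j Q = P} f Q` (the fibre sum); `contractL_lawLP_apply_pat₀` — the contracted boundary law of a `k+2`-marked
  domain evaluated at (the link pattern of) an outermost `k`-pattern `p` is `Σ_{q : q.contract j = p} N_q`;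
* ★★★ `lawLP_eq_add_contractL` — **THE LAW ASSEMBLY**: if at a boundary mid-edge the outermost-pattern counts of three marked domains `D'`, `D` (`k` corners)
  and `D₊` (`k+2` corners) satisfy `N^{D'}_p = N^{D}_p + Σ_{q : q.contract j = p} N^{D₊}_q` for every outermost `p`, then
  **`lawLP z' = lawLP z + contractL j (lawLP z₊)`** in the planar Temperley–Lieb module — the shape of the lane's surgery F2 («attach a whole outer path between the
  corner faces `y_j`, `y_{j+1}`»: the configurations avoiding the path are those of `D`, `MarkedLoopLawAttachSplit.patternCount_eq_add_present`; those containing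
  it biject, by deleting it, with the configurations of the domain `D₊` marked additionally at the path's two end faces, the pattern contracting at `j, j+1`).

Also: `skip_castSucc_castSucc`, `skip_castSucc_last` (`Fin` bookkeeping: the closing site `*` is never contracted), `mem_closeUp_iff`, `castSucc_mem_closeUp_iff`,
`castSucc_last_mem_closeUp_iff` (membership in the closed-up relation), `pat₀EquivLinkPattern_partner_eq_iff`, `mem_closeUp_symm_iff` (the bridge on partners),
`LinkPattern.connectSucc_partner_eq_iff` (the partner of a third site after the move at `j, j+1`, in closed form), `Pat₀.mem_closeUp_contract_iff`.

## References
* P. A. Pearce, V. Rittenberg, J. de Gier, B. Nienhuis, *Temperley–Lieb stochastic processes*, J. Phys. A 35 (2002) L661–L668, §2 ((monoid); (TL) with `q + q⁻¹ = 1`;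
  the link-pattern module).
* M. Khristoforov, S. Smirnov, *Percolation and O(1) loop model*, arXiv:2111.15612v1 (2021), §1.2 (p. 2: loop configurations, «matching marked points», the law of the
  link pattern).

## Mathlib / tree
Tree: `MarkedLoopTemperleyLiebCoords` (`pat₀EquivLinkPattern`, `pat₀EquivLinkPattern_apply`), `MarkedLoopTemperleyLieb` (`NCMatching.toPM`, `NCMatching.mem_iff_partner_eq`,
`ncMatchingEquivLinkPattern`, `relOfPM`, `mem_relOfPM`), `MarkedLoopTripodBasis` (`Pat₀`, `closeUp`, `liftRel`, `withPair`, `pat₀EquivNCMatching`, `patternCount`),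
`MarkedLoopHolomorphy` (`mem_withPair`), `MarkedLoopBoundaryLawModule` (`lawLP`, `lawLP_apply_pat₀`), `LatticeModels/TemperleyLiebCapContract` (`skip`, `skip_val`,
`skip_injective`, `skip_ne_castSucc/succ`, `PerfectMatching.skip_contract_partner`, `LinkPattern.contractSucc`, `contractL`), `TemperleyLiebLinkModule`
(`LinkPattern.connectSucc_val`), `TemperleyLiebLinkRelations` (`PerfectMatching.connect_partner_eq`). Mathlib: `Finsupp.mapDomain`, `Finsupp.sum_fintype`,
`Finsupp.finsetSum_apply`, `Finsupp.single_apply`, `Equiv.sum_comp`.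
-/

namespace Literature.Probability.Percolation.MarkedLoops

open Literature.Probability.Percolation Literature.Probability.LatticeModels
open Literature.Probability.LatticeModels.TemperleyLieb
open TriMarkedDomain Finset

/-! ### `Fin` bookkeeping: `skip` at `j⁺ = castSucc j` on lifted sites -/

section FinLemmas

variable {k : ℕ}

/-- `skip j⁺ x⁺ = (skip j x)⁺`: skipping the lifted sites `j, j+1` commutes with the lift `castSucc`. [cite: PearceRittenbergDeGierNienhuis2002, §2 (link diagrams)] -/
theorem skip_castSucc_castSucc (j : Fin (k + 1)) (x : Fin k) : skip (Fin.castSucc j) (Fin.castSucc x) = Fin.castSucc (skip j x) := by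
  apply Fin.ext
  rw [skip_val, Fin.val_castSucc, Fin.val_castSucc, Fin.val_castSucc, skip_val]

/-- `skip j⁺ * = *`: the closing last site is never one of the two skipped sites `j, j+1 ≤ k`. [cite: PearceRittenbergDeGierNienhuis2002, §2 (link diagrams)] -/
theorem skip_castSucc_last (j : Fin (k + 1)) : skip (Fin.castSucc j) (Fin.last k) = Fin.last (k + 1 + 1) := by
  apply Fin.ext
  rw [skip_val, Fin.val_last, Fin.val_castSucc, Fin.val_last, if_neg (not_lt.2 (Nat.le_of_lt_succ j.2))]

end FinLemmas

/-! ### Membership in the closed-up relation and the bridge on partner functions -/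

section CloseUp

variable {m : ℕ}

/-- membership in the closed-up relation of an outermost pattern: the closing pair `{j⁺, *}` or a lifted pair.
[cite: KhristoforovSmirnov2021, §1.2 (arXiv v1 p. 2: «matching marked points»)] -/
theorem mem_closeUp_iff (q : Pat₀ m) {x y : Fin (m + 1)} :
    (x, y) ∈ (closeUp q).1 ↔ (x = Fin.castSucc q.1.1.1 ∧ y = Fin.last m) ∨ (x = Fin.last m ∧ y = Fin.castSucc q.1.1.1) ∨
      ∃ a b : Fin m, (a, b) ∈ q.1.1.2 ∧ Fin.castSucc a = x ∧ Fin.castSucc b = y := by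
  show (x, y) ∈ withPair (liftRel q.1.1.2) (Fin.castSucc q.1.1.1) (Fin.last m) ↔ _
  rw [mem_withPair]
  unfold liftRel
  rw [Finset.mem_image]
  refine or_congr Iff.rfl (or_congr Iff.rfl ⟨?_, ?_⟩)
  · rintro ⟨⟨a, b⟩, hab, h⟩
    exact ⟨a, b, hab, (Prod.mk.inj h).1, (Prod.mk.inj h).2⟩
  · rintro ⟨a, b, hab, rfl, rfl⟩
    exact ⟨(a, b), hab, rfl⟩

/-- lifted pairs of the closed-up relation are the pairs of the pattern. [cite: KhristoforovSmirnov2021, §1.2 (arXiv v1 p. 2)] -/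
theorem castSucc_mem_closeUp_iff (q : Pat₀ m) {a b : Fin m} : (Fin.castSucc a, Fin.castSucc b) ∈ (closeUp q).1 ↔ (a, b) ∈ q.1.1.2 := by
  rw [mem_closeUp_iff]
  constructor
  · rintro (⟨-, h⟩ | ⟨h, -⟩ | ⟨a', b', h, ha, hb⟩)
    · exact absurd h (Fin.castSucc_lt_last b).ne
    · exact absurd h (Fin.castSucc_lt_last a).ne
    · rw [Fin.castSucc_inj] at ha hb
      rw [← ha, ← hb]; exact h
  · exact fun h => Or.inr (Or.inr ⟨a, b, h, rfl, rfl⟩)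

/-- the closing site `*` is paired exactly with (the lift of) the disorder's partner. [cite: KhristoforovSmirnov2021, §1.2 (arXiv v1 p. 2)] -/
theorem castSucc_last_mem_closeUp_iff (q : Pat₀ m) {a : Fin m} : (Fin.castSucc a, Fin.last m) ∈ (closeUp q).1 ↔ a = q.1.1.1 := by
  rw [mem_closeUp_iff]
  constructor
  · rintro (⟨h, -⟩ | ⟨h, -⟩ | ⟨a', b', -, -, hb⟩)
    · exact Fin.castSucc_inj.1 h
    · exact absurd h (Fin.castSucc_lt_last a).ne
    · exact absurd hb (Fin.castSucc_lt_last b').ne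
  · rintro rfl; exact Or.inl ⟨rfl, rfl⟩

/-- **the bridge on partners**: the partner function of the link pattern of `q` is membership in the closed-up relation.
[cite: KhristoforovSmirnov2021, §1.2 (arXiv v1 p. 2); PearceRittenbergDeGierNienhuis2002, §2 (link patterns)] -/
theorem pat₀EquivLinkPattern_partner_eq_iff (q : Pat₀ m) {x y : Fin (m + 1)} : (pat₀EquivLinkPattern m q).1.partner x = y ↔ (x, y) ∈ (closeUp q).1 := by
  rw [NCMatching.mem_iff_partner_eq]; rfl

/-- **the bridge on partners, inverse direction**: the closed-up relation of the pattern behind a link pattern `P` is the relation of `P`.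
[cite: KhristoforovSmirnov2021, §1.2 (arXiv v1 p. 2); PearceRittenbergDeGierNienhuis2002, §2 (link patterns)] -/
theorem mem_closeUp_symm_iff (P : LinkPattern (m + 1)) {x y : Fin (m + 1)} : (x, y) ∈ (closeUp ((pat₀EquivLinkPattern m).symm P)).1 ↔ P.1.partner x = y := by
  have h : closeUp ((pat₀EquivLinkPattern m).symm P) = (ncMatchingEquivLinkPattern (m + 1)).symm P := by
    show pat₀EquivNCMatching m ((pat₀EquivNCMatching m).symm ((ncMatchingEquivLinkPattern (m + 1)).symm P)) = _
    rw [Equiv.apply_symm_apply]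
  rw [h]
  exact mem_relOfPM

end CloseUp

/-! ### The partner of a third site after the move at `j, j+1` -/

section Connect

variable {n : ℕ}

/-- **after the move at `j, j+1`, a site `u ∉ {j, j+1}` is paired with `w ∉ {j, j+1}` iff** `u, w` were partners, or `u ~ j` and `j+1 ~ w`, or `u ~ j+1` and `j ~ w`
(the two strands ending at `j` and `j+1` are joined by the cup). [cite: PearceRittenbergDeGierNienhuis2002, §2 (monoid)] -/
theorem LinkPattern.connectSucc_partner_eq_iff (P : LinkPattern (n + 1 + 1)) (j : Fin (n + 1)) {u w : Fin (n + 1 + 1)} (hu1 : u ≠ Fin.castSucc j) (hu2 : u ≠ j.succ)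
    (hw1 : w ≠ Fin.castSucc j) (hw2 : w ≠ j.succ) :
    (P.connectSucc j).1.partner u = w ↔ P.1.partner u = w ∨ (P.1.partner u = Fin.castSucc j ∧ P.1.partner j.succ = w) ∨
      (P.1.partner u = j.succ ∧ P.1.partner (Fin.castSucc j) = w) := by
  have hab : Fin.castSucc j ≠ j.succ := ne_of_lt Fin.castSucc_lt_succ
  rw [LinkPattern.connectSucc_val, PerfectMatching.connect_partner_eq P.1 hab u, if_neg hu1, if_neg hu2]
  by_cases h1 : u = P.1.partner (Fin.castSucc j)
  · have e1 : P.1.partner u = Fin.castSucc j := by rw [h1, P.1.partner_partner]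
    rw [if_pos h1]
    constructor
    · exact fun h => Or.inr (Or.inl ⟨e1, h⟩)
    · rintro (h | ⟨-, h⟩ | ⟨h, -⟩)
      · exact absurd (e1.symm.trans h) hw1.symm
      · exact h
      · exact absurd (e1.symm.trans h) hab
  have n1 : P.1.partner u ≠ Fin.castSucc j := fun e => h1 (by rw [← e, P.1.partner_partner])
  rw [if_neg h1]
  by_cases h2 : u = P.1.partner j.succ
  · have e2 : P.1.partner u = j.succ := by rw [h2, P.1.partner_partner]
    rw [if_pos h2]
    constructor
    · exact fun h => Or.inr (Or.inr ⟨e2, h⟩)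
    · rintro (h | ⟨h, -⟩ | ⟨-, h⟩)
      · exact absurd (e2.symm.trans h) hw2.symm
      · exact absurd h n1
      · exact h
  have n2 : P.1.partner u ≠ j.succ := fun e => h2 (by rw [← e, P.1.partner_partner])
  rw [if_neg h2]
  constructor
  · exact Or.inl
  · rintro (h | ⟨h, -⟩ | ⟨h, -⟩)
    · exact h
    · exact absurd h n1
    · exact absurd h n2

end Connect

/-! ### The contraction of an outermost pattern at two adjacent corners -/

section Contract

variable {k : ℕ}

namespace Pat₀

/-- **THE CONTRACTION OF AN OUTERMOST PATTERN of `k+2` corners AT THE ADJACENT CORNERS `j, j+1`** (join the strands through `y_j` and `y_{j+1}`, forget the two corners,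
relabel the others by `skip j`), defined through the bridge `Pat₀ _ ≃ LinkPattern (_+1)` by Pearce–Rittenberg–de Gier–Nienhuis's contraction at the sites `j, j+1`.
[cite: PearceRittenbergDeGierNienhuis2002, §2 (monoid: the cup joins two strands; erase closed loops); KhristoforovSmirnov2021, §1.2 (arXiv v1 p. 2)] -/
noncomputable def contract (j : Fin (k + 1)) (q : Pat₀ (k + 1 + 1)) : Pat₀ k :=
  (pat₀EquivLinkPattern k).symm ((pat₀EquivLinkPattern (k + 1 + 1) q).contractSucc (Fin.castSucc j))

/-- **the contraction IS the Temperley–Lieb contraction in link-pattern coordinates** (by definition). [cite: PearceRittenbergDeGierNienhuis2002, §2 (monoid)] -/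
theorem pat₀EquivLinkPattern_contract (j : Fin (k + 1)) (q : Pat₀ (k + 1 + 1)) :
    pat₀EquivLinkPattern k (q.contract j) = (pat₀EquivLinkPattern (k + 1 + 1) q).contractSucc (Fin.castSucc j) :=
  Equiv.apply_symm_apply _ _

/-- membership in the closed-up contracted pattern = being partners after the move, read through `skip j⁺`. [cite: PearceRittenbergDeGierNienhuis2002, §2 (monoid)] -/
theorem mem_closeUp_contract_iff (j : Fin (k + 1)) (q : Pat₀ (k + 1 + 1)) {x y : Fin (k + 1)} :
    (x, y) ∈ (closeUp (q.contract j)).1 ↔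
      ((pat₀EquivLinkPattern (k + 1 + 1) q).connectSucc (Fin.castSucc j)).1.partner (skip (Fin.castSucc j) x) = skip (Fin.castSucc j) y := by
  unfold contract
  rw [mem_closeUp_symm_iff]
  show (PerfectMatching.contract (Fin.castSucc j) _ (((pat₀EquivLinkPattern (k + 1 + 1) q).connectSucc_partner_castSucc (Fin.castSucc j)))).partner x = y ↔ _
  rw [← (skip_injective (Fin.castSucc j)).eq_iff, PerfectMatching.skip_contract_partner]

/-- ★★ **THE LINK RELATION OF THE CONTRACTED PATTERN IN CLOSED FORM**: `a ~ b` in `q.contract j` iff, in `q`, `skip j a ~ skip j b`, or `skip j a ~ j` and `j+1 ~ skip j b`, or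
`skip j a ~ j+1` and `j ~ skip j b`. [cite: PearceRittenbergDeGierNienhuis2002, §2 (monoid: the cup joins the two strands); KhristoforovSmirnov2021, §1.2 (arXiv v1 p. 2)] -/
theorem mem_contract_iff (j : Fin (k + 1)) (q : Pat₀ (k + 1 + 1)) {a b : Fin k} :
    (a, b) ∈ (q.contract j).1.1.2 ↔
      (skip j a, skip j b) ∈ q.1.1.2 ∨ ((skip j a, Fin.castSucc j) ∈ q.1.1.2 ∧ (j.succ, skip j b) ∈ q.1.1.2) ∨
        ((skip j a, j.succ) ∈ q.1.1.2 ∧ (Fin.castSucc j, skip j b) ∈ q.1.1.2) := by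
  have ha1 : Fin.castSucc (skip j a) ≠ Fin.castSucc (Fin.castSucc j) := fun e => skip_ne_castSucc j a (Fin.castSucc_inj.1 e)
  have ha2 : Fin.castSucc (skip j a) ≠ (Fin.castSucc j).succ := fun e =>
    skip_ne_succ j a (Fin.castSucc_inj.1 (e.trans (Fin.succ_castSucc j)))
  have hb1 : Fin.castSucc (skip j b) ≠ Fin.castSucc (Fin.castSucc j) := fun e => skip_ne_castSucc j b (Fin.castSucc_inj.1 e)
  have hb2 : Fin.castSucc (skip j b) ≠ (Fin.castSucc j).succ := fun e =>
    skip_ne_succ j b (Fin.castSucc_inj.1 (e.trans (Fin.succ_castSucc j)))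
  rw [← castSucc_mem_closeUp_iff, mem_closeUp_contract_iff, skip_castSucc_castSucc, skip_castSucc_castSucc,
    LinkPattern.connectSucc_partner_eq_iff _ _ ha1 ha2 hb1 hb2, Fin.succ_castSucc, pat₀EquivLinkPattern_partner_eq_iff,
    pat₀EquivLinkPattern_partner_eq_iff, pat₀EquivLinkPattern_partner_eq_iff, pat₀EquivLinkPattern_partner_eq_iff, pat₀EquivLinkPattern_partner_eq_iff,
    castSucc_mem_closeUp_iff, castSucc_mem_closeUp_iff, castSucc_mem_closeUp_iff, castSucc_mem_closeUp_iff, castSucc_mem_closeUp_iff]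

/-- ★★ **THE PARTNER OF THE CONTRACTED PATTERN IN CLOSED FORM**: the disorder's partner in `q.contract j` is `x` iff `skip j x` is the partner in `q`, or `skip j x ~ j` and the
partner is `j+1`, or `skip j x ~ j+1` and the partner is `j`. [cite: PearceRittenbergDeGierNienhuis2002, §2 (monoid); KhristoforovSmirnov2021, §1.2 (arXiv v1 p. 2)] -/
theorem contract_partner_eq_iff (j : Fin (k + 1)) (q : Pat₀ (k + 1 + 1)) {x : Fin k} :
    (q.contract j).1.1.1 = x ↔
      skip j x = q.1.1.1 ∨ ((skip j x, Fin.castSucc j) ∈ q.1.1.2 ∧ q.1.1.1 = j.succ) ∨ ((skip j x, j.succ) ∈ q.1.1.2 ∧ q.1.1.1 = Fin.castSucc j) := by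
  have hx1 : Fin.castSucc (skip j x) ≠ Fin.castSucc (Fin.castSucc j) := fun e => skip_ne_castSucc j x (Fin.castSucc_inj.1 e)
  have hx2 : Fin.castSucc (skip j x) ≠ (Fin.castSucc j).succ := fun e =>
    skip_ne_succ j x (Fin.castSucc_inj.1 (e.trans (Fin.succ_castSucc j)))
  have hl1 : Fin.last (k + 1 + 1) ≠ Fin.castSucc (Fin.castSucc j) := (Fin.castSucc_lt_last _).ne'
  have hl2 : Fin.last (k + 1 + 1) ≠ (Fin.castSucc j).succ := by rw [Fin.succ_castSucc]; exact (Fin.castSucc_lt_last _).ne'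
  rw [eq_comm, ← castSucc_last_mem_closeUp_iff, mem_closeUp_contract_iff, skip_castSucc_castSucc, skip_castSucc_last,
    LinkPattern.connectSucc_partner_eq_iff _ _ hx1 hx2 hl1 hl2, Fin.succ_castSucc, pat₀EquivLinkPattern_partner_eq_iff,
    pat₀EquivLinkPattern_partner_eq_iff, pat₀EquivLinkPattern_partner_eq_iff, pat₀EquivLinkPattern_partner_eq_iff, pat₀EquivLinkPattern_partner_eq_iff,
    castSucc_mem_closeUp_iff, castSucc_mem_closeUp_iff, castSucc_last_mem_closeUp_iff, castSucc_last_mem_closeUp_iff, castSucc_last_mem_closeUp_iff]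
  rw [show (j.succ = q.1.1.1) = (q.1.1.1 = j.succ) from propext eq_comm, show (Fin.castSucc j = q.1.1.1) = (q.1.1.1 = Fin.castSucc j) from propext eq_comm]

end Pat₀

end Contract

/-! ### The contracted law: fibre sums and the assembly -/

section Fibre

variable (R : Type*) [CommRing R] {n : ℕ}

/-- **the contraction evaluated at a link pattern is the sum over the fibre**: `(contractL j f) P = Σ_{Q : contractSucc j Q = P} f Q`.
[cite: PearceRittenbergDeGierNienhuis2002, §2 (monoid)] -/
theorem contractL_apply_eq_sum (j : Fin (n + 1)) (f : LinkPattern (n + 1 + 1) →₀ R) (P : LinkPattern n) :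
    contractL R j f P = ∑ Q ∈ Finset.univ.filter (fun Q : LinkPattern (n + 1 + 1) => Q.contractSucc j = P), f Q := by
  rw [contractL, Finsupp.lmapDomain_apply, Finsupp.mapDomain, Finsupp.sum_fintype _ _ (fun _ => Finsupp.single_zero _), Finsupp.finsetSum_apply,
    Finset.sum_filter]
  exact Finset.sum_congr rfl fun Q _ => Finsupp.single_apply

variable {R}

/-- **the contracted boundary law of a `k+2`-marked domain, evaluated at an outermost `k`-pattern `p`, is `Σ_{q : q.contract j = p} N_q`.**
[cite: KhristoforovSmirnov2021, §1.2 (arXiv v1 p. 2: the law of the link pattern); PearceRittenbergDeGierNienhuis2002, §2 (monoid)] -/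
theorem contractL_lawLP_apply_pat₀ {E : TriMarkedDomain (n + 1 + 1 + 1)} (zE : ArcPoint E (Fin.last (n + 1 + 1))) (j : Fin (n + 1 + 1)) (p : Pat₀ (n + 1)) :
    contractL ℂ (Fin.castSucc j) (lawLP zE) (pat₀EquivLinkPattern (n + 1) p) =
      ∑ q ∈ Finset.univ.filter (fun q : Pat₀ (n + 1 + 1 + 1) => q.contract j = p), (patternCount E zE.v zE.i q.1 : ℂ) := by
  rw [contractL_apply_eq_sum, Finset.sum_filter, Finset.sum_filter, ← (pat₀EquivLinkPattern (n + 1 + 1 + 1)).sum_comp]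
  refine Finset.sum_congr rfl fun q _ => ?_
  rw [← Pat₀.pat₀EquivLinkPattern_contract, lawLP_apply_pat₀]
  exact if_congr (pat₀EquivLinkPattern (n + 1)).apply_eq_iff_eq rfl rfl

/-- ★★★ **THE LAW ASSEMBLY**: if at a boundary mid-edge the outermost-pattern counts of `D'`, `D` (`k` corners) and `D₊` (`k+2` corners) satisfy
`N^{D'}_p = N^{D}_p + Σ_{q : q.contract j = p} N^{D₊}_q` for every outermost `p`, then `lawLP z' = lawLP z + contractL j (lawLP zE)` in the planar Temperley–Lieb module
(the surgery
«attach a whole outer path between the corner faces `y_j`, `y_{j+1}`» contributes the CONTRACTION of the law of the domain marked additionally at the path's two end faces).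
[cite: KhristoforovSmirnov2021, §1.2 (arXiv v1 p. 2: the law of the link pattern); PearceRittenbergDeGierNienhuis2002, §2 (monoid; the link-pattern module)] -/
theorem lawLP_eq_add_contractL {D' D : TriMarkedDomain (n + 1)} {E : TriMarkedDomain (n + 1 + 1 + 1)} (z' : ArcPoint D' (Fin.last n)) (z : ArcPoint D (Fin.last n))
    (zE : ArcPoint E (Fin.last (n + 1 + 1))) (j : Fin (n + 1 + 1))
    (hcount : ∀ p : Pat₀ (n + 1), patternCount D' z'.v z'.i p.1 =
      patternCount D z.v z.i p.1 + ∑ q ∈ Finset.univ.filter (fun q : Pat₀ (n + 1 + 1 + 1) => q.contract j = p), patternCount E zE.v zE.i q.1) :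
    lawLP z' = lawLP z + contractL ℂ (Fin.castSucc j) (lawLP zE) := by
  ext Q
  obtain ⟨p, rfl⟩ := (pat₀EquivLinkPattern (n + 1)).surjective Q
  rw [Finsupp.add_apply, lawLP_apply_pat₀, lawLP_apply_pat₀, contractL_lawLP_apply_pat₀, hcount p, Nat.cast_add, Nat.cast_sum]

end Fibre

end Literature.Probability.Percolation.MarkedLoops
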